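import Summits.CriticalPhenomena.PercolationContinuityZ3.Theorems.PercNearOneGluingNoHeavyLowerTailCILRelayNeighboursSeparation
import Literature.Probability.Percolation.LonelyClusterExchange
import HarnessLib

/-!
# `NoHeavyLowerTail` (stmt-CriticalPhenomena-4575) — the QUANTITATIVE lonelier-member lemma
# ("gluing an observer set costs a dominated witness at most its lightness gap to ANY member")

Support file (prover `prim-hp-5`, hull-port cell, blob-quotient technique; `--supports stmt-CriticalPhenomena-4575`).
No definitions, no named facts, no sorries.

Setting: `μ = prodBernoulli w` on `Fin n`, relays `A`, level `j`, `π(v) = {z ∈ A : v ↔ z}`, `R_v = {|π(v)| ≤ j}` (`v` is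
"light"), an observer SET `O` (any finite set of vertices) and a witness vertex `c`.  The two sides of the set-champion
stability inequality `CS(O, c)` of the blob-quotient / cumulative-isolation line are
`L(O,c) = μ(c ↮ O, 1 ≤ |π(O)| ≤ j)` and `R(O,c) = μ(c ↮ O, |π(c)| ≤ j)`, where `c ↮ O` means `c ↮ x` for every `x ∈ O`
and `π(O) = ⋃_{x ∈ O} π(x)`; `R(O,c) − L(O,c)` is the advantage of `c` over the BLOB `O` in the graph with `O` glued.

* `Literature.….observerSet_le_of_lonelier` (van den Berg–Häggström–Kahn Thm 1.5): if `O` has a member `y` with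
  `μ(R_y) ≤ μ(R_c)` then `L(O,c) ≤ R(O,c)`.
* THIS FILE, `CutObserver.observerSet_le_add_gap`: if instead `μ(R_c) ≤ μ(R_y)` for a member `y ∈ O` (the witness is
  DOMINATED by `y`), then still `L(O,c) ≤ R(O,c) + (μ(R_y) − μ(R_c))` — the deficiency of `CS(O,c)` is at most the lightness
  gap between `c` and ANY member of `O`.  Together (`CutObserver.observerSet_le_add_posPart`): for every `y ∈ O`,
  `L(O,c) ≤ R(O,c) + (μ(R_y) − μ(R_c))⁺`, i.e. `R(O,c) − L(O,c) ≥ − min_{y ∈ O} (μ(R_y) − μ(R_c))⁺`.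

PROOF.  `{1 ≤ |π(O)| ≤ j} ⊆ R_y`, so it suffices to show `μ(R_c ∖ S) ≤ μ(R_y ∖ S)` for `S = {c ↮ O}`.  Off `S` the witness
touches `O`: either `c ↔ y` — there `π(c) = π(y)` and the two events agree — or `c ↮ y` and `c` touches `O ∖ {y}` (event `T`).
On `T ∩ {c ↮ y}` the common part `R_c ∩ R_y` cancels and what is left is `μ(T ∩ X) ≤ μ(T ∩ Y)` for `X = {|π(c)| ≤ j < |π(y)|}`,
`Y = {|π(y)| ≤ j < |π(c)|}`; the heavy/light exchange `CutObserver.hit_heavyLight_exchange` (‡) (two instances of the two-cluster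
exchange inequality, BHK Thm 1.5) gives `μ(T ∩ X)·μ(Y) ≤ μ(T ∩ Y)·μ(X)`, and the hypothesis is `μ(X) ≤ μ(Y)`.

Numerics preceding the proof (this seat, exact partition DP, folder lab/qlm*.py, star2/3.py): 0 violations in ≈ 30 000 exact
(graph, O, c, y) tests incl. |O| = 2, 3, levels 1–3, n ≤ 7, and capped adversarial climbs (minimum margin > 0 off the glued locus,
→ 0 as the cap → 1); the sharper intermediate inequality `μ(T ∩ X) ≤ μ(T ∩ Y)` likewise 0/16 000.

Use (crux evidence / NOTES of prim-hp-5): with the star decomposition at the observer (`…CILStarTransfer`) or the hull partition,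
this bounds the deficiency of CIL / XZ at any witness `q` by `E_σ[min_{y ∈ σ} (s_y − s_q)⁺]` over the random star `σ` — the
quantitative form of "a star containing a vertex no lighter than `q` is free".
-/

noncomputable section

namespace Summit.CriticalPhenomena.PercolationContinuityZ3.Theorems

open MeasureTheory Set Literature.Probability.LatticeModels Literature.Probability.Percolation
open scoped Classical BigOperators

variable {n : ℕ}

namespace CutObserver

/-- **Quantitative lonelier-member lemma (gap form).**  For a finite observer set `O`, a member `y ∈ O` and a vertex `c` with
`μ(R_c) ≤ μ(R_y)` (`R_v = {|π(v)| ≤ j}`):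
`μ(c ↮ O, 1 ≤ |π(O)| ≤ j) + μ(R_c) ≤ μ(c ↮ O, |π(c)| ≤ j) + μ(R_y)`.
[cite: VandenbergHaggstromKahn2005, Thm. 1.5 (p. 7) — via CutObserver.hit_heavyLight_exchange] -/
theorem observerSet_le_add_gap (w : Sym2 (Fin n) → unitInterval) (A O : Finset (Fin n)) (y c : Fin n)
    (hy : y ∈ O) (j : ℕ)
    (hle : (prodBernoulli w).real {ω : BondConfig (Fin n) | (A.filter fun z => ω ∈ openConn c z).card ≤ j} ≤
      (prodBernoulli w).real {ω : BondConfig (Fin n) | (A.filter fun z => ω ∈ openConn y z).card ≤ j}) :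
    (prodBernoulli w).real {ω : BondConfig (Fin n) | (∀ x ∈ O, ω ∉ openConn c x) ∧
        1 ≤ (A.filter fun z => ∃ x ∈ O, ω ∈ openConn x z).card ∧
        (A.filter fun z => ∃ x ∈ O, ω ∈ openConn x z).card ≤ j} +
      (prodBernoulli w).real {ω : BondConfig (Fin n) | (A.filter fun z => ω ∈ openConn c z).card ≤ j} ≤
    (prodBernoulli w).real {ω : BondConfig (Fin n) | (∀ x ∈ O, ω ∉ openConn c x) ∧
        (A.filter fun z => ω ∈ openConn c z).card ≤ j} +
      (prodBernoulli w).real {ω : BondConfig (Fin n) | (A.filter fun z => ω ∈ openConn y z).card ≤ j} := by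
  haveI : IsProbabilityMeasure (prodBernoulli w) := inferInstance
  set μ := prodBernoulli w with hμ
  -- relay counts
  set Mc : BondConfig (Fin n) → ℕ := fun ω => (A.filter fun z => ω ∈ openConn c z).card with hMc
  set My : BondConfig (Fin n) → ℕ := fun ω => (A.filter fun z => ω ∈ openConn y z).card with hMy
  set MO : BondConfig (Fin n) → ℕ := fun ω => (A.filter fun z => ∃ x ∈ O, ω ∈ openConn x z).card
    with hMO
  -- events
  set Rc := {ω : BondConfig (Fin n) | Mc ω ≤ j} with hRc
  set Ry := {ω : BondConfig (Fin n) | My ω ≤ j} with hRy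
  set S := {ω : BondConfig (Fin n) | ∀ x ∈ O, ω ∉ openConn c x} with hS
  set LO := {ω : BondConfig (Fin n) | (∀ x ∈ O, ω ∉ openConn c x) ∧ 1 ≤ MO ω ∧ MO ω ≤ j} with hLO
  set RO := {ω : BondConfig (Fin n) | (∀ x ∈ O, ω ∉ openConn c x) ∧ Mc ω ≤ j} with hRO
  set U : Set (BondConfig (Fin n)) := openConn c y with hU
  set T := {ω : BondConfig (Fin n) | ∃ m ∈ O.erase y, ω ∈ openConn c m} with hT
  -- the same objects in the `Reachable` spelling of `CutObserver.hit_heavyLight_exchange`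
  have hfc : ∀ (v : Fin n) (ω : BondConfig (Fin n)),
      (A.filter fun z => (openGraph ω).Reachable v z) = (A.filter fun z => ω ∈ openConn v z) :=
    fun v ω => Finset.filter_congr fun z _ => Iff.rfl
  set X := {ω : BondConfig (Fin n) | Mc ω ≤ j ∧ j < My ω} with hX
  set Y := {ω : BondConfig (Fin n) | My ω ≤ j ∧ j < Mc ω} with hY
  change μ.real LO + μ.real Rc ≤ μ.real RO + μ.real Ry
  change μ.real Rc ≤ μ.real Ry at hle
  have hmeas : ∀ s : Set (BondConfig (Fin n)), MeasurableSet s := fun s => (Set.toFinite s).measurableSet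
  -- the case `c = y`: both CS events are empty (`c ↮ y` fails since `y ∈ O`)
  by_cases hcy : c = y
  · subst hcy
    have h1 : LO = ∅ := by
      ext ω
      simp only [hLO, mem_setOf_eq, mem_empty_iff_false, iff_false, not_and]
      intro h
      exact absurd (show ω ∈ openConn c c from (SimpleGraph.Reachable.refl c : (openGraph ω).Reachable c c)) (h c hy)
    rw [h1, measureReal_empty, zero_add]
    exact hle.trans (le_add_of_nonneg_left measureReal_nonneg)
  -- counts agree along a connection
  have hsame : ∀ ω : BondConfig (Fin n), ω ∈ U → Mc ω = My ω := by
    intro ω h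
    have h' : (openGraph ω).Reachable c y := h
    simp only [hMc, hMy]
    congr 1
    exact Finset.filter_congr fun x _ =>
      ⟨fun hx => (h'.symm.trans hx : (openGraph ω).Reachable y x), fun hx => (h'.trans hx : (openGraph ω).Reachable c x)⟩
  -- `π(y) ⊆ π(O)`, hence `{1 ≤ |π(O)| ≤ j} ⊆ R_y`
  have hMyO : ∀ ω : BondConfig (Fin n), My ω ≤ MO ω := by
    intro ω
    simp only [hMy, hMO]
    exact Finset.card_le_card fun z hz => by
      rw [Finset.mem_filter] at hz ⊢
      exact ⟨hz.1, y, hy, hz.2⟩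
  -- Step 1: `LO ⊆ S ∩ Ry`
  have h1 : μ.real LO ≤ μ.real (Ry ∩ S) := by
    refine measureReal_mono ?_
    intro ω hω
    simp only [hLO, mem_setOf_eq] at hω
    refine ⟨?_, hω.1⟩
    change My ω ≤ j
    exact (hMyO ω).trans hω.2.2
  -- Step 2: `RO = Rc ∩ S`
  have h2 : RO = Rc ∩ S := by
    ext ω
    simp only [hRO, hRc, hS, mem_setOf_eq, mem_inter_iff]
    tauto
  -- Step 3: splitting along `S`
  have hsc : μ.real (Rc ∩ S) + μ.real (Rc \ S) = μ.real Rc := measureReal_inter_add_sdiff (hmeas S)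
  have hsy : μ.real (Ry ∩ S) + μ.real (Ry \ S) = μ.real Ry := measureReal_inter_add_sdiff (hmeas S)
  -- Step 4: off `S`, split along `U = {c ↔ y}`
  have hUc : μ.real ((Rc \ S) ∩ U) + μ.real ((Rc \ S) \ U) = μ.real (Rc \ S) :=
    measureReal_inter_add_sdiff (hmeas U)
  have hUy : μ.real ((Ry \ S) ∩ U) + μ.real ((Ry \ S) \ U) = μ.real (Ry \ S) :=
    measureReal_inter_add_sdiff (hmeas U)
  -- on `U` the two light events coincide (and `U` is disjoint from `S`)
  have hU1 : (Rc \ S) ∩ U = (Ry \ S) ∩ U := by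
    ext ω
    simp only [hRc, hRy, hS, hU, mem_inter_iff, mem_sdiff, mem_setOf_eq]
    constructor
    · rintro ⟨⟨h1, h2⟩, h3⟩
      exact ⟨⟨by rw [← hsame ω h3]; exact h1, h2⟩, h3⟩
    · rintro ⟨⟨h1, h2⟩, h3⟩
      exact ⟨⟨by rw [hsame ω h3]; exact h1, h2⟩, h3⟩
  -- off `S ∪ U` the witness touches `O ∖ {y}`
  have hoff : ∀ ω : BondConfig (Fin n), ω ∉ S → ω ∉ U → ω ∈ T := by
    intro ω hS' hU'
    simp only [hS, mem_setOf_eq, not_forall, not_not] at hS'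
    obtain ⟨x, hx, hcx⟩ := hS'
    have hxy : x ≠ y := by
      rintro rfl; exact hU' hcx
    exact ⟨x, Finset.mem_erase.2 ⟨hxy, hx⟩, hcx⟩
  have hTS : ∀ ω : BondConfig (Fin n), ω ∈ T → ω ∉ S := by
    intro ω hω hS'
    obtain ⟨m, hm, hcm⟩ := hω
    exact hS' m (Finset.mem_of_mem_erase hm) hcm
  have hU2c : (Rc \ S) \ U = (Rc ∩ T) \ U := by
    ext ω
    simp only [mem_sdiff, mem_inter_iff]
    constructor
    · rintro ⟨⟨h1, h2⟩, h3⟩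
      exact ⟨⟨h1, hoff ω h2 h3⟩, h3⟩
    · rintro ⟨⟨h1, h2⟩, h3⟩
      exact ⟨⟨h1, hTS ω h2⟩, h3⟩
  have hU2y : (Ry \ S) \ U = (Ry ∩ T) \ U := by
    ext ω
    simp only [mem_sdiff, mem_inter_iff]
    constructor
    · rintro ⟨⟨h1, h2⟩, h3⟩
      exact ⟨⟨h1, hoff ω h2 h3⟩, h3⟩
    · rintro ⟨⟨h1, h2⟩, h3⟩
      exact ⟨⟨h1, hTS ω h2⟩, h3⟩
  -- Step 5: split `(R· ∩ T) \ U` along the other light event; the common part cancels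
  have hVc : μ.real (((Rc ∩ T) \ U) ∩ Ry) + μ.real (((Rc ∩ T) \ U) \ Ry) = μ.real ((Rc ∩ T) \ U) :=
    measureReal_inter_add_sdiff (hmeas Ry)
  have hVy : μ.real (((Ry ∩ T) \ U) ∩ Rc) + μ.real (((Ry ∩ T) \ U) \ Rc) = μ.real ((Ry ∩ T) \ U) :=
    measureReal_inter_add_sdiff (hmeas Rc)
  have hcommon : ((Rc ∩ T) \ U) ∩ Ry = ((Ry ∩ T) \ U) ∩ Rc := by
    ext ω
    simp only [mem_sdiff, mem_inter_iff]
    tauto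
  have hXe : ((Rc ∩ T) \ U) \ Ry = T ∩ X := by
    ext ω
    simp only [hRc, hRy, hX, hU, mem_sdiff, mem_inter_iff, mem_setOf_eq, not_le]
    constructor
    · rintro ⟨⟨⟨h1, h2⟩, _⟩, h4⟩
      exact ⟨h2, h1, h4⟩
    · rintro ⟨h2, h1, h4⟩
      refine ⟨⟨⟨h1, h2⟩, fun h3 => ?_⟩, h4⟩
      have := hsame ω h3
      omega
  have hYe : ((Ry ∩ T) \ U) \ Rc = T ∩ Y := by
    ext ω
    simp only [hRc, hRy, hY, hU, mem_sdiff, mem_inter_iff, mem_setOf_eq, not_le]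
    constructor
    · rintro ⟨⟨⟨h1, h2⟩, _⟩, h4⟩
      exact ⟨h2, h1, h4⟩
    · rintro ⟨h2, h1, h4⟩
      refine ⟨⟨⟨h1, h2⟩, fun h3 => ?_⟩, h4⟩
      have := hsame ω h3
      omega
  -- Step 6: `μ(X) ≤ μ(Y)` from the hypothesis
  have hXc : μ.real (Rc ∩ Ry) + μ.real (Rc \ Ry) = μ.real Rc := measureReal_inter_add_sdiff (hmeas Ry)
  have hYc : μ.real (Ry ∩ Rc) + μ.real (Ry \ Rc) = μ.real Ry := measureReal_inter_add_sdiff (hmeas Rc)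
  have hXd : Rc \ Ry = X := by
    ext ω; simp only [hRc, hRy, hX, mem_sdiff, mem_setOf_eq, not_le]
  have hYd : Ry \ Rc = Y := by
    ext ω; simp only [hRc, hRy, hY, mem_sdiff, mem_setOf_eq, not_le]
  have hXY : μ.real X ≤ μ.real Y := by
    rw [← hXd, ← hYd]
    rw [inter_comm] at hYc
    linarith
  -- Step 7: the heavy/light exchange (‡) and the transfer `μ(T ∩ X) ≤ μ(T ∩ Y)`
  have hdd := hit_heavyLight_exchange w A hcy (O.erase y) j
  simp only [hfc] at hdd
  change μ.real (T ∩ X) * μ.real Y ≤ μ.real (T ∩ Y) * μ.real X at hdd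
  have hTXY : μ.real (T ∩ X) ≤ μ.real (T ∩ Y) := by
    by_cases hY0 : μ.real Y = 0
    · have hX0 : μ.real X = 0 := le_antisymm (hY0 ▸ hXY) measureReal_nonneg
      have : μ.real (T ∩ X) ≤ μ.real X := measureReal_mono inter_subset_right
      linarith [measureReal_nonneg (μ := μ) (s := T ∩ Y), measureReal_nonneg (μ := μ) (s := T ∩ X)]
    · have hYpos : 0 < μ.real Y := lt_of_le_of_ne measureReal_nonneg (Ne.symm hY0)
      have h' : μ.real (T ∩ X) * μ.real Y ≤ μ.real (T ∩ Y) * μ.real Y :=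
        hdd.trans (mul_le_mul_of_nonneg_left hXY measureReal_nonneg)
      exact le_of_mul_le_mul_right h' hYpos
  -- Step 8: assemble
  rw [h2]
  rw [hU1, hU2c] at hUc
  rw [hU2y] at hUy
  rw [hcommon, hXe] at hVc
  rw [hYe] at hVy
  linarith [h1, hsc, hsy, hUc, hUy, hVc, hVy, hTXY]

/-- **Quantitative lonelier-member lemma (positive-part form).**  For every member `y` of a finite observer set `O` and
every vertex `c`:  `μ(c ↮ O, 1 ≤ |π(O)| ≤ j) ≤ μ(c ↮ O, |π(c)| ≤ j) + max (μ(R_y) − μ(R_c)) 0`.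
The case `μ(R_y) ≤ μ(R_c)` is `Literature.….observerSet_le_of_lonelier`, the other case is `observerSet_le_add_gap`.
[cite: VandenbergHaggstromKahn2005, Thm. 1.5 (p. 7) — via the two lemmas named] -/
theorem observerSet_le_add_posPart (w : Sym2 (Fin n) → unitInterval) (A O : Finset (Fin n)) (y c : Fin n)
    (hy : y ∈ O) (j : ℕ) :
    (prodBernoulli w).real {ω : BondConfig (Fin n) | (∀ x ∈ O, ω ∉ openConn c x) ∧
        1 ≤ (A.filter fun z => ∃ x ∈ O, ω ∈ openConn x z).card ∧
        (A.filter fun z => ∃ x ∈ O, ω ∈ openConn x z).card ≤ j} ≤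
    (prodBernoulli w).real {ω : BondConfig (Fin n) | (∀ x ∈ O, ω ∉ openConn c x) ∧
        (A.filter fun z => ω ∈ openConn c z).card ≤ j} +
      max ((prodBernoulli w).real {ω : BondConfig (Fin n) | (A.filter fun z => ω ∈ openConn y z).card ≤ j} -
        (prodBernoulli w).real {ω : BondConfig (Fin n) | (A.filter fun z => ω ∈ openConn c z).card ≤ j}) 0 := by
  set Iy := (prodBernoulli w).real {ω : BondConfig (Fin n) | (A.filter fun z => ω ∈ openConn y z).card ≤ j} with hIy
  set Ic := (prodBernoulli w).real {ω : BondConfig (Fin n) | (A.filter fun z => ω ∈ openConn c z).card ≤ j} with hIc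
  by_cases h : Iy ≤ Ic
  · have key := observerSet_le_of_lonelier w A O y c hy j h
    have key' := key.trans (le_add_of_nonneg_right (le_max_right (Iy - Ic) 0))
    refine le_trans (le_of_eq ?_) (le_trans key' (le_of_eq ?_))
    · congr 1
      ext ω
      simp only [mem_setOf_eq]
      have hf : ∀ (p q : Fin n → Prop) (hp : DecidablePred p) (hq : DecidablePred q), (∀ z, p z ↔ q z) →
          @Finset.filter _ p hp A = @Finset.filter _ q hq A := fun p q hp hq hpq =>
        Finset.filter_congr fun z _ => hpq z
      rw [hf (fun z => ∃ x ∈ O, ω ∈ openConn x z) (fun z => ∃ x ∈ O, ω ∈ openConn x z) _ _ fun z => Iff.rfl]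
    · rfl
  · push Not at h
    have key := observerSet_le_add_gap w A O y c hy j h.le
    have hm : max (Iy - Ic) 0 = Iy - Ic := max_eq_left (by linarith)
    rw [hm]
    linarith

end CutObserver

end Summit.CriticalPhenomena.PercolationContinuityZ3.Theorems

end
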